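import Summits.BirchSwinnertonDyer.BirchSwinnertonDyer.Theses.KatoDescentTamePotSupersingular
import Summits.BirchSwinnertonDyer.BirchSwinnertonDyer.Theorems.KatoDescentTamePotSupersingularTameUpperOptimalSharpNodesMult
import HarnessLib

/-!
# Route `KatoDescentTamePotSupersingular` (rung K8, sub-rung B4 (t′), cell `bsd-potss`): CLOSER of the glue item
# `TameUpperNonsurjTowerOfOptimalSharpRoad` (R100c v2, the U₀-ns node re-cut ON THE OPTIMAL MEMBER of the class) —
# one line over this seat's kernel p487508 (`TameUpperOptimalSharpNodesMult.upperNonsurjTower_of_jetchevReadingMult_of_cruxAResidue`);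
# seat `bsd-potss-k8t-c4` g7. Closes a GLUE item only: the cruxes `TameJetchevIrreducibleReading` (Jetchev 2008 Cor. 1.5
# in the irreducible reading, D-audit PASS ref g28) and `TameCoatesSujathaResidue` (Coates–Sujatha (A) on the residue
# classes) stay OPEN as typed; BSD is not proved by any of this.

The glue says: the Jetchev irreducible reading (`TameJetchevIrreducibleReading`), the Heegner-road published inputs
(`PublishedInputsHeegnerT`: Gross–Zagier, Kolyvagin, Matar–Nekovář, newforms, Bump–Friedberg–Hoffstein), Cassels'
isogeny invariance (`PublishedInputCasselsIsogenyRedT`), Coates–Sujatha's (A) on the residue classes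
(`TameCoatesSujathaResidue`), the lower half L₀ (`TameLowerHalfRankZero`), the rank-one residual (`TameRankOne`),
`KatoTamagawaExactInputs` and `PublishedInputsFineSelmerCM` imply the U₀-ns node `TameUpperNonsurjTower` — which is
`TameUpperOptimalSharpNodesMult.upperNonsurjTower_of_jetchevReadingMult_of_cruxAResidue` with the Heegner conjunction destructured.
-/

set_option autoImplicit false
-- the Theorems directory repeats the summit name (sibling precedent `KatoDescentPotSupersingularAssembly.lean`)
set_option linter.dupNamespace false

noncomputable section

namespace Summit.BirchSwinnertonDyer.BirchSwinnertonDyer.Theorems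

open Summit.BirchSwinnertonDyer.BirchSwinnertonDyer.Theses.KatoDescentTamePotSupersingular

/-- **Closer of the glue item `TameUpperNonsurjTowerOfOptimalSharpRoad`** (type = the route decl BY NAME): destructure
the held Heegner conjunction and apply this seat's optimal-member node
`TameUpperOptimalSharpNodesMult.upperNonsurjTower_of_jetchevReadingMult_of_cruxAResidue` (kernel p487508). Glue only; the two cruxes it
consumes stay open; nothing about BSD is asserted. [cite: Jetchev2008, Thm. 1.4, Cor. 1.5 (p. 3), Rem. 6.2 (p. 15)]
[cite: MatarNekovar2019, Thm. 0.3 (p. 456), §0.11 (p. 457)] [cite: MilneADT2006, Thm. I.7.3] -/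
theorem tameUpperNonsurjTowerOfOptimalSharpRoad_proof :
    Summit.BirchSwinnertonDyer.BirchSwinnertonDyer.Theses.KatoDescentTamePotSupersingular.TameUpperNonsurjTowerOfOptimalSharpRoad :=
  fun hJr hH hC₄ hCS a81 a84 a91 a87 =>
    TameUpperOptimalSharpNodesMult.upperNonsurjTower_of_jetchevReadingMult_of_cruxAResidue
      hJr hH.1 hH.2.1 hH.2.2.1 hH.2.2.2.1 hH.2.2.2.2 hC₄ hCS a81 a84 a91 a87

end Summit.BirchSwinnertonDyer.BirchSwinnertonDyer.Theorems

end
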